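import Literature.NumberTheory.QuadraticFields.IdealsOfPrimePowerNorm
import HarnessLib

/-!
# Quadratic fields — the ideals of prime-power norm: split, ramified, inert

Topic `NumberTheory/QuadraticFields`; proof companion of `IdealsOfPrimePowerNorm.lean` (every ideal
of norm `p^e` of `𝓞 K = ℤ ⊕ ℤω`, `ω² = m + tω`, is `𝔭^i 𝔭'^j`, `𝔭 = (p, ω − k)`, `𝔭' = (p, ω − (t − k))`,
once `p ∣ k² − tk − m`). Everything here is PROVED; no definition, no named fact.

The three cases of the enumeration of the ideals of norm `p^e` (Cox, *Primes of the form
x² + ny²*, §5.B Prop. 5.16; Cohen, *A Course in Computational Algebraic Number Theory*, §5.2):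

* `span_pair_ne_conj`, `eq_of_pow_mul_pow_eq` — **split** (`p ∤ 2k − t`): `𝔭 ≠ 𝔭'`, and
  `𝔭^i 𝔭'^j = 𝔭^{i'} 𝔭'^{j'}` forces `i = i'`, so the `e + 1` ideals `𝔭^i 𝔭'^{e−i}` are distinct;
* `span_pair_conj_eq_of_dvd`, `eq_pow_of_absNorm_eq_of_dvd` — **ramified** (`p ∣ 2k − t`):
  `𝔭' = 𝔭` and the only ideal of norm `p^e` is `𝔭^e`;
* `even_and_eq_span_pow_of_absNorm_eq` — **inert** (no `k` with `p ∣ k² − tk − m`): an ideal of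
  norm `p^e` has `e` even and equals `(p)^{e/2}`.

## References

* D. A. Cox, *Primes of the form x² + ny²*, 2nd ed. (2013), §5.B Prop. 5.16, §7.B Thm. 7.7 [Cox2013].
* H. Cohen, *A Course in Computational Algebraic Number Theory*, GTM 138 (1993), §5.2 [Cohen1993].
-/

noncomputable section

open Module NumberField Ideal

namespace Literature.NumberTheory.QuadraticFields.Quadratic

variable {K : Type*} [Field K] [NumberField K] (b : Basis (Fin 2) ℤ (𝓞 K)) (hb : b 0 = 1)
  {t m : ℤ} (hω : b 1 * b 1 = (m : 𝓞 K) + (t : 𝓞 K) * b 1)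

/-! ### Split, ramified, inert -/

omit [NumberField K] in
include hb hω in
/-- **Split primes: `𝔭 ≠ 𝔭'` when `p ∤ 2k − t`** (else `2k − t = (ω − (t − k)) − (ω − k) ∈ 𝔭 ∩ ℤ = pℤ`).
[cite: Cox2013, §5.B Prop. 5.16] -/
theorem span_pair_ne_conj {p : ℕ} {k C : ℤ} (hn : (p : ℤ) * C = k ^ 2 - t * k - m)
    (hsplit : ¬ (p : ℤ) ∣ 2 * k - t) :
    span {((p : ℤ) : 𝓞 K), b 1 - k} ≠ span {((p : ℤ) : 𝓞 K), b 1 - ((t - k : ℤ) : 𝓞 K)} := by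
  intro h
  have h1 : b 1 - ((t - k : ℤ) : 𝓞 K) ∈ span {((p : ℤ) : 𝓞 K), b 1 - k} :=
    h ▸ subset_span (by simp)
  have h2 : b 1 - (k : 𝓞 K) ∈ span {((p : ℤ) : 𝓞 K), b 1 - k} := subset_span (by simp)
  have h3 : ((2 * k - t : ℤ) : 𝓞 K) ∈ span {((p : ℤ) : 𝓞 K), b 1 - k} := by
    have : ((2 * k - t : ℤ) : 𝓞 K) = (b 1 - ((t - k : ℤ) : 𝓞 K)) - (b 1 - (k : 𝓞 K)) := by
      push_cast; ring
    rw [this]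
    exact Ideal.sub_mem _ h1 h2
  exact hsplit ((intCast_mem_span_pair_iff b hb hω hn _).1 h3)

include hb hω in
/-- In the split case no positive power of `𝔭` divides a power of `𝔭'`. [folklore] -/
theorem not_pow_dvd_conj_pow {p : ℕ} (hp : p.Prime) {k C : ℤ}
    (hn : (p : ℤ) * C = k ^ 2 - t * k - m) (hsplit : ¬ (p : ℤ) ∣ 2 * k - t) {n : ℕ} (hn0 : n ≠ 0)
    (j : ℕ) :
    ¬ span {((p : ℤ) : 𝓞 K), b 1 - k} ^ n ∣ span {((p : ℤ) : 𝓞 K), b 1 - ((t - k : ℤ) : 𝓞 K)} ^ j := by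
  set 𝔭 : Ideal (𝓞 K) := span {((p : ℤ) : 𝓞 K), b 1 - k}
  set 𝔭' : Ideal (𝓞 K) := span {((p : ℤ) : 𝓞 K), b 1 - ((t - k : ℤ) : 𝓞 K)}
  intro h
  have hmax := isMaximal_of_absNorm_eq_prime hp (absNorm_span_pair_prime b hb hω hn)
  have hmax' := isMaximal_of_absNorm_eq_prime hp
    (absNorm_span_pair_prime b hb hω (norm_eq_conj hn) (p := p))
  have h0 : 𝔭 ≠ ⊥ := by
    intro h0
    have := absNorm_span_pair_prime b hb hω hn
    rw [show span {((p : ℤ) : 𝓞 K), b 1 - k} = 𝔭 from rfl, h0, absNorm_bot] at this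
    exact hp.ne_zero this.symm
  have hPr : Prime 𝔭 := prime_of_isPrime h0 hmax.isPrime
  have h1 : 𝔭 ∣ 𝔭' ^ j := (dvd_pow_self 𝔭 hn0).trans h
  have h2 : 𝔭 ∣ 𝔭' := hPr.dvd_of_dvd_pow h1
  have h3 : 𝔭' ≤ 𝔭 := Ideal.dvd_iff_le.1 h2
  exact span_pair_ne_conj b hb hω hn hsplit (hmax'.eq_of_le hmax.ne_top h3).symm

include hb hω in
/-- **Split primes: `𝔭^i 𝔭'^j = 𝔭^{i'} 𝔭'^{j'}` with `i + j = i' + j'` forces `i = i'`**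
(cancel the common power of `𝔭`; a positive power of `𝔭` would divide a power of `𝔭' ≠ 𝔭`).
[cite: Cox2013, §7.B Thm. 7.7] -/
theorem eq_of_pow_mul_pow_eq {p : ℕ} (hp : p.Prime) {k C : ℤ}
    (hn : (p : ℤ) * C = k ^ 2 - t * k - m) (hsplit : ¬ (p : ℤ) ∣ 2 * k - t) {i j i' j' : ℕ}
    (heq : span {((p : ℤ) : 𝓞 K), b 1 - k} ^ i *
        span {((p : ℤ) : 𝓞 K), b 1 - ((t - k : ℤ) : 𝓞 K)} ^ j =
      span {((p : ℤ) : 𝓞 K), b 1 - k} ^ i' *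
        span {((p : ℤ) : 𝓞 K), b 1 - ((t - k : ℤ) : 𝓞 K)} ^ j') : i = i' := by
  set 𝔭 : Ideal (𝓞 K) := span {((p : ℤ) : 𝓞 K), b 1 - k}
  set 𝔭' : Ideal (𝓞 K) := span {((p : ℤ) : 𝓞 K), b 1 - ((t - k : ℤ) : 𝓞 K)}
  have h0 : 𝔭 ≠ 0 := by
    intro h0
    have := absNorm_span_pair_prime b hb hω hn
    rw [show span {((p : ℤ) : 𝓞 K), b 1 - k} = 𝔭 from rfl, h0, map_zero] at this
    exact hp.ne_zero this.symm
  -- from `𝔭^a 𝔭'^c = 𝔭^{a+n} X` with `n ≥ 1` derive `𝔭^n ∣ 𝔭'^c`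
  have key : ∀ {a c n : ℕ} {X : Ideal (𝓞 K)}, 𝔭 ^ a * 𝔭' ^ c = 𝔭 ^ (a + n) * X → 𝔭 ^ n ∣ 𝔭' ^ c := by
    intro a c n X h
    have h' : 𝔭 ^ a * 𝔭' ^ c = 𝔭 ^ a * (𝔭 ^ n * X) := by rw [h, pow_add, mul_assoc]
    have := mul_left_cancel₀ (pow_ne_zero a h0) h'
    exact ⟨X, this⟩
  rcases Nat.lt_trichotomy i i' with hlt | heq' | hgt
  · exfalso
    obtain ⟨n, rfl⟩ : ∃ n, i' = i + (n + 1) := ⟨i' - i - 1, by omega⟩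
    exact not_pow_dvd_conj_pow b hb hω hp hn hsplit (Nat.succ_ne_zero n) j
      (key (X := 𝔭' ^ j') heq)
  · exact heq'
  · exfalso
    obtain ⟨n, rfl⟩ : ∃ n, i = i' + (n + 1) := ⟨i - i' - 1, by omega⟩
    exact not_pow_dvd_conj_pow b hb hω hp hn hsplit (Nat.succ_ne_zero n) j'
      (key (X := 𝔭' ^ j) heq.symm)

omit [NumberField K] in
/-- **Ramified primes: `𝔭' = 𝔭` when `p ∣ 2k − t`** (`k − (t − k) = 2k − t`).
[cite: Cox2013, §5.B Prop. 5.16] -/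
theorem span_pair_conj_eq_of_dvd {p : ℕ} {k : ℤ} (hram : (p : ℤ) ∣ 2 * k - t) :
    span {((p : ℤ) : 𝓞 K), b 1 - ((t - k : ℤ) : 𝓞 K)} = span {((p : ℤ) : 𝓞 K), b 1 - k} := by
  have h := span_pair_eq_span_pair_of_dvd_sub (b 1) (A := (p : ℤ)) (k := t - k) (k' := k)
    (by have : t - k - k = -(2 * k - t) := by ring
        rw [this, dvd_neg]; exact hram)
  simpa using h

include hb hω in
/-- **Ramified primes: the only ideal of norm `p^e` is `𝔭^e`.** [cite: Cox2013, §7.B Thm. 7.7] -/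
theorem eq_pow_of_absNorm_eq_of_dvd {p : ℕ} (hp : p.Prime) {k C : ℤ}
    (hn : (p : ℤ) * C = k ^ 2 - t * k - m)
    (hprim : ∀ d : ℤ, d ∣ (p : ℤ) → d ∣ 2 * k - t → d ∣ C → IsUnit d)
    (hram : (p : ℤ) ∣ 2 * k - t) {e : ℕ} {I : Ideal (𝓞 K)} (hI : absNorm I = p ^ e) :
    I = span {((p : ℤ) : 𝓞 K), b 1 - k} ^ e := by
  obtain ⟨i, j, hij, hIeq⟩ := exists_eq_pow_mul_pow_of_absNorm_eq b hb hω hp hn hprim hI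
  rw [hIeq, span_pair_conj_eq_of_dvd b hram, ← pow_add, hij]

include hb hω in
/-- **Inert primes**: if no `k` has `p ∣ k² − tk − m` (no ideal of norm `p`), an ideal of norm
`p^e` has `e` even and equals `(p)^{e/2}`: a maximal `P ∋ p` divides `(p)`, of norm `p²`, and
`N P ∉ {1, p}`, so `P = (p)`; induct on `e`. [cite: Cox2013, §5.B Prop. 5.16] -/
theorem even_and_eq_span_pow_of_absNorm_eq {p : ℕ} (hp : p.Prime)
    (hinert : ∀ k C : ℤ, (p : ℤ) * C ≠ k ^ 2 - t * k - m) {e : ℕ} {I : Ideal (𝓞 K)}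
    (hI : absNorm I = p ^ e) : 2 ∣ e ∧ I = span {(p : 𝓞 K)} ^ (e / 2) := by
  induction e using Nat.strong_induction_on generalizing I with
  | _ e ih =>
    rcases e with _ | e
    · refine ⟨dvd_zero 2, ?_⟩
      rw [pow_zero] at hI
      rw [absNorm_eq_one_iff.1 hI, Nat.zero_div, pow_zero, one_eq_top]
    have hItop : I ≠ ⊤ := by
      rintro rfl
      rw [absNorm_top] at hI
      have : 1 < p ^ (e + 1) := Nat.one_lt_pow (Nat.succ_ne_zero e) hp.one_lt
      omega
    obtain ⟨P, hPmax, hIP⟩ := exists_le_maximal I hItop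
    have hpP : (p : 𝓞 K) ∈ P := by
      have h1 : ((absNorm I : ℕ) : 𝓞 K) ∈ P := hIP (absNorm_mem I)
      rw [hI, Nat.cast_pow] at h1
      exact hPmax.isPrime.mem_of_pow_mem _ h1
    -- `P = (p)`
    have hPeq : P = span {(p : 𝓞 K)} := by
      have hle : span {(p : 𝓞 K)} ≤ P := (span_singleton_le_iff_mem _).2 hpP
      obtain ⟨M, hM⟩ := Ideal.dvd_iff_le.2 hle
      have hnorm := congrArg absNorm hM
      rw [show span {(p : 𝓞 K)} = span {(p : 𝓞 K)} ^ 1 from (pow_one _).symm,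
        absNorm_span_singleton_natCast_pow b, mul_one, map_mul] at hnorm
      have hdvd : absNorm P ∣ p ^ 2 := ⟨_, hnorm⟩
      obtain ⟨i, hi2, hi⟩ := (Nat.dvd_prime_pow hp).1 hdvd
      interval_cases i
      · exact absurd (absNorm_eq_one_iff.1 (by simpa using hi)) hPmax.ne_top
      · exfalso
        rw [pow_one] at hi
        obtain ⟨k, C, hkC, -⟩ := exists_eq_span_pair_of_absNorm_eq_prime b hb hω hp hi
        exact hinert k C hkC
      · rw [hi] at hnorm
        have hM1 : absNorm M = 1 := by
          have : p ^ 2 * absNorm M = p ^ 2 * 1 := by rw [mul_one]; exact hnorm.symm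
          exact Nat.eq_of_mul_eq_mul_left (pow_pos hp.pos 2) this
        rw [absNorm_eq_one_iff.1 hM1, mul_top] at hM
        exact hM.symm
    rw [hPeq] at hIP
    obtain ⟨J, hJ⟩ := Ideal.dvd_iff_le.2 hIP
    have hnJ := congrArg absNorm hJ
    rw [map_mul, hI, show span {(p : 𝓞 K)} = span {(p : 𝓞 K)} ^ 1 from (pow_one _).symm,
      absNorm_span_singleton_natCast_pow b, mul_one] at hnJ
    -- `e ≥ 1` and `N J = p^{e-1}`
    have hJ0 : absNorm J ≠ 0 := by
      intro h0
      rw [h0, mul_zero] at hnJ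
      exact pow_ne_zero _ hp.ne_zero hnJ
    have he1 : 1 ≤ e := by
      by_contra hlt
      have he0 : e = 0 := by omega
      rw [he0, zero_add, pow_one] at hnJ
      have : p ^ 2 ≤ p := by
        calc p ^ 2 ≤ p ^ 2 * absNorm J := Nat.le_mul_of_pos_right _ (Nat.pos_of_ne_zero hJ0)
          _ = p := hnJ.symm
      have h2 : p < p ^ 2 := by
        calc p = p ^ 1 := (pow_one p).symm
          _ < p ^ 2 := Nat.pow_lt_pow_right hp.one_lt (by norm_num)
      omega
    have hJn : absNorm J = p ^ (e - 1) := by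
      have : p ^ 2 * absNorm J = p ^ 2 * p ^ (e - 1) := by
        rw [← hnJ, ← pow_add]; congr 1; omega
      exact Nat.eq_of_mul_eq_mul_left (pow_pos hp.pos 2) this
    obtain ⟨hev, hJeq⟩ := ih (e - 1) (by omega) hJn
    refine ⟨by omega, ?_⟩
    rw [hJ, hJeq, ← pow_succ']
    congr 1
    omega

end Literature.NumberTheory.QuadraticFields.Quadratic

end
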